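import Summits.SmoothPoincare4.SmoothPoincare4.Theorems.CongruenceShadowsGriffithsHandlebodyExtensionCoverGenusOne
import Summits.SmoothPoincare4.SmoothPoincare4.Theorems.CongruenceShadowsGriffithsHandlebodyExtension
import Literature.Topology.FourManifolds.HandlebodyKernelExtensionBased
import HarnessLib

/-!
# SmoothPoincare4 / CongruenceShadows — `GriffithsHandlebodyExtension` (item stmt-SmoothPoincare4-15190): the item from the BASED flower criterion alone

Support file (`--supports` stmt-SmoothPoincare4-15190).  It records, against the ROUTE DECLS by
name, the sharpest reduction of the item the tree now affords:

* `roundSolidTorus_diffeoExtends_of_map_ker_eq_ker` — the genus-one input `h₁` of the Literature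
  reduction `Literature.Topology.FourManifolds.griffithsExtension_of_forall_diffeoExtends_of_flower_based`
  (Griffiths' kernel criterion on the Heegaard torus `∂V` of the round solid torus, any base point)
  is DISCHARGED, by the unconditional genus-one theorem `HomothetyCover.griffiths_genus_one`
  (`…CoverGenusOne.lean`, homothety-cover proof of (E), no mapping-class-group input);
* `griffithsExtension_of_flower_based` (the Literature fact itself),
  `griffithsHandlebodyExtension_of_flower_based` (CongruenceShadows copy) and
  `groupTrisection_griffithsHandlebodyExtension_of_flower_based` (GroupTrisection copy) — **the whole item follows from
  the BASED flower criterion in genus `g ≥ 2` alone**: every self-diffeomorphism of the flower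
  surface `∂V_g = ∂(FlowerModel.FlowerHandlebody hg)` fixing the north pole `x₀` and carrying
  `ker (π₁(∂V_g, x₀) → π₁ V_g)` onto itself extends over `V_g`.  That hypothesis (binder `h₂`,
  verbatim the `h₂` of the Literature reduction) is Griffiths' theorem (1964, main theorem;
  Hensel (2020), Cor. 5.11 with Lemma 5.10: Dehn's lemma and disc surgery) for ONE model per genus
  at ONE base point — the residual, crux-sized obligation of the item; a proof `C₂` of it closes
  stmt-SmoothPoincare4-15190 by `griffithsHandlebodyExtension_of_flower_based C₂`.

References: [GriffithsHB1964Handlebody] main theorem; [Hensel2020HandlebodyPrimer] Cor. 5.11,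
Lemma 5.10.
-/

-- the registered namespace `Summit.SmoothPoincare4.SmoothPoincare4.Theorems` repeats a component
set_option linter.dupNamespace false

noncomputable section

namespace Summit.SmoothPoincare4.SmoothPoincare4.Theorems

open scoped _root_.Manifold _root_.ContDiff
open Literature.Topology.FourManifolds Literature.Topology.FourManifolds.RoundSolidTorusModel
  Literature.Topology.FourManifolds.FlowerModel
open Summit.SmoothPoincare4.SmoothPoincare4.Theses

/-- **Griffiths' kernel criterion on the round solid torus, unconditionally**: every
self-diffeomorphism `χ` of the Heegaard torus `∂V` of the round solid torus `V` whose induced map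
carries `ker (π₁(∂V, y₀) → π₁ V)` onto `ker (π₁(∂V, χ y₀) → π₁ V)` extends over `V` — the
genus-one input `h₁` of `griffithsExtension_of_forall_diffeoExtends_of_flower_based`, discharged by
`HomothetyCover.griffiths_genus_one` at `H = V`, `b = BoundaryManifold.boundaryData 2 V`.
[cite: GriffithsHB1964Handlebody, main theorem (genus 1)] -/
theorem roundSolidTorus_diffeoExtends_of_map_ker_eq_ker
    (χ : (𝓡∂ 3).boundary RoundSolidTorus ≃ₘ⟮𝓡 2, 𝓡 2⟯ (𝓡∂ 3).boundary RoundSolidTorus)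
    (y₀ : (𝓡∂ 3).boundary RoundSolidTorus)
    (hker : ((FundamentalGroup.map bdryIncl y₀).ker).map
          (FundamentalGroup.map (⟨χ, χ.continuous⟩ : C(_, _)) y₀)
        = (FundamentalGroup.map bdryIncl ((⟨χ, χ.continuous⟩ : C(_, _)) y₀)).ker) :
    (BoundaryManifold.boundaryData 2 RoundSolidTorus).DiffeoExtends χ :=
  HomothetyCover.griffiths_genus_one RoundSolidTorus isHandlebody_one_roundSolidTorus
    (BoundaryManifold.boundaryData 2 RoundSolidTorus) χ y₀ hker

/-- **The Literature fact from the BASED flower criterion alone**: `GriffithsExtension` (all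
genera, all handlebodies, all boundary data, all base points) from Griffiths' criterion for the
flower handlebodies of genus `≥ 2` at the north pole. [cite: GriffithsHB1964Handlebody, main theorem] -/
theorem griffithsExtension_of_flower_based
    (h₂ : ∀ (g : ℕ) (hg : 2 ≤ g)
      (ψ : (𝓡∂ 3).boundary (FlowerHandlebody hg) ≃ₘ⟮𝓡 2, 𝓡 2⟯ (𝓡∂ 3).boundary (FlowerHandlebody hg)),
      ψ (northPole hg) = northPole hg →
      ((FundamentalGroup.map (⟨(BoundaryManifold.boundaryData 2 (FlowerHandlebody hg)).incl,
          (BoundaryManifold.boundaryData 2 (FlowerHandlebody hg)).continuous_incl⟩ :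
            C((𝓡∂ 3).boundary (FlowerHandlebody hg), FlowerHandlebody hg)) (northPole hg)).ker).map
          (FundamentalGroup.map (⟨ψ, ψ.continuous⟩ : C(_, _)) (northPole hg))
        = (FundamentalGroup.map (⟨(BoundaryManifold.boundaryData 2 (FlowerHandlebody hg)).incl,
            (BoundaryManifold.boundaryData 2 (FlowerHandlebody hg)).continuous_incl⟩ :
              C((𝓡∂ 3).boundary (FlowerHandlebody hg), FlowerHandlebody hg))
            ((⟨ψ, ψ.continuous⟩ : C(_, _)) (northPole hg))).ker →
      (BoundaryManifold.boundaryData 2 (FlowerHandlebody hg)).DiffeoExtends ψ) :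
    GriffithsExtension :=
  griffithsExtension_of_forall_diffeoExtends_of_flower_based
    roundSolidTorus_diffeoExtends_of_map_ker_eq_ker h₂

/-- **The item from the BASED flower criterion alone** (CongruenceShadows copy): if, for every
`g ≥ 2`, every self-diffeomorphism `ψ` of the flower surface `∂V_g` fixing the north pole `x₀` and
carrying `ker (π₁(∂V_g, x₀) → π₁ V_g)` onto itself extends over the flower handlebody `V_g`, then
`GriffithsHandlebodyExtension` holds (genus `0`: `Γ₃ = 0`; genus `1`:
`roundSolidTorus_diffeoExtends_of_map_ker_eq_ker`; one model per genus and one base point suffice: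
`griffithsExtension_of_forall_diffeoExtends_of_flower_based`).  The hypothesis is Griffiths'
theorem for the model `V_g`, `g ≥ 2`. [cite: GriffithsHB1964Handlebody, main theorem]
[cite: Hensel2020HandlebodyPrimer, Cor. 5.11 and Lemma 5.10] -/
theorem griffithsHandlebodyExtension_of_flower_based
    (h₂ : ∀ (g : ℕ) (hg : 2 ≤ g)
      (ψ : (𝓡∂ 3).boundary (FlowerHandlebody hg) ≃ₘ⟮𝓡 2, 𝓡 2⟯ (𝓡∂ 3).boundary (FlowerHandlebody hg)),
      ψ (northPole hg) = northPole hg →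
      ((FundamentalGroup.map (⟨(BoundaryManifold.boundaryData 2 (FlowerHandlebody hg)).incl,
          (BoundaryManifold.boundaryData 2 (FlowerHandlebody hg)).continuous_incl⟩ :
            C((𝓡∂ 3).boundary (FlowerHandlebody hg), FlowerHandlebody hg)) (northPole hg)).ker).map
          (FundamentalGroup.map (⟨ψ, ψ.continuous⟩ : C(_, _)) (northPole hg))
        = (FundamentalGroup.map (⟨(BoundaryManifold.boundaryData 2 (FlowerHandlebody hg)).incl,
            (BoundaryManifold.boundaryData 2 (FlowerHandlebody hg)).continuous_incl⟩ :
              C((𝓡∂ 3).boundary (FlowerHandlebody hg), FlowerHandlebody hg))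
            ((⟨ψ, ψ.continuous⟩ : C(_, _)) (northPole hg))).ker →
      (BoundaryManifold.boundaryData 2 (FlowerHandlebody hg)).DiffeoExtends ψ) :
    CongruenceShadows.GriffithsHandlebodyExtension :=
  griffithsExtension_of_flower_based h₂

/-- **The item from the BASED flower criterion alone** (GroupTrisection copy of the route decl).
[cite: GriffithsHB1964Handlebody, main theorem] -/
theorem groupTrisection_griffithsHandlebodyExtension_of_flower_based
    (h₂ : ∀ (g : ℕ) (hg : 2 ≤ g)
      (ψ : (𝓡∂ 3).boundary (FlowerHandlebody hg) ≃ₘ⟮𝓡 2, 𝓡 2⟯ (𝓡∂ 3).boundary (FlowerHandlebody hg)),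
      ψ (northPole hg) = northPole hg →
      ((FundamentalGroup.map (⟨(BoundaryManifold.boundaryData 2 (FlowerHandlebody hg)).incl,
          (BoundaryManifold.boundaryData 2 (FlowerHandlebody hg)).continuous_incl⟩ :
            C((𝓡∂ 3).boundary (FlowerHandlebody hg), FlowerHandlebody hg)) (northPole hg)).ker).map
          (FundamentalGroup.map (⟨ψ, ψ.continuous⟩ : C(_, _)) (northPole hg))
        = (FundamentalGroup.map (⟨(BoundaryManifold.boundaryData 2 (FlowerHandlebody hg)).incl,
            (BoundaryManifold.boundaryData 2 (FlowerHandlebody hg)).continuous_incl⟩ :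
              C((𝓡∂ 3).boundary (FlowerHandlebody hg), FlowerHandlebody hg))
            ((⟨ψ, ψ.continuous⟩ : C(_, _)) (northPole hg))).ker →
      (BoundaryManifold.boundaryData 2 (FlowerHandlebody hg)).DiffeoExtends ψ) :
    GroupTrisection.GriffithsHandlebodyExtension :=
  griffithsExtension_of_flower_based h₂

end Summit.SmoothPoincare4.SmoothPoincare4.Theorems

end
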